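import Mathlib
import HarnessLib
import Summits.HubbardSuperconductivity.HubbardSuperconductivity.Theorems.KLProgrammeKLRegimeEnginePairTransferOutClassCapShares
import Summits.HubbardSuperconductivity.HubbardSuperconductivity.Theorems.KLProgrammeKLRegimeEngineV8PairTransferExport8

/-!
# Route `KLProgramme` — ENGINE item stmt-HubbardSuperconductivity-20437 `KLRegimeEngineV17F2`, stub (c) value lane under AMENDMENT 25 «(X).3-KLTS-CAP»:
# THE CAPPED RESIDUE ROWS AT THE DEFERRED CONSTANT `klCT8`, `U`-SMALLNESS FROM THE BUNDLED u-SLOT `klCTu8T` — the (c) closer's `hE` / bracket inputs BY NAME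
# (cell gate-hubbard-kl, seat hubbard-kl-p1 g23; pen (R282)(1): «the klCT8 closer instances at the token … = p1's»; k3c2-p2 g21's CapShares p664671 + p1's Export8 p669055)

WHY.  `…PairTransferOutClassCapShares` books the class-#5 bar's non-gain residue `E₂(r) = 2r·15367(KlamU)²/L + 4r·15367(Klam|U|)³2^{−(n+1)}` into `½·eremBar` for ANY
`0 ≤ r ≤ 2²⁰(1+klTS)` under the `Q`-floor of record and ONE `U`-smallness `hTU : 2²⁶·klTS·(Klam·|U|) ≤ 1`; `…V8PairTransferExport8` fixes the bar's prefactor at the deferred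
constant `r := klCT8 P R Q₀ G′ klEngGeoTh` (`klCT8_nonneg`, `klCT8_le_cap`) and carries `hTU` in the bundled u-slot (`hTU_of_le_klCTu8T : 0 < U → U ≤ klCTu8T … → hTU`).
This file is the composition, so the (c) closer at the rev-15 token (`⊓ klCTu8T P R (klEngQ7 P R) klEngGeo14 klEngGeoTh (klEngQ9c P R) cc`) reads ONE name per binder:
* §1 **`relBar_klCT8_residue_le_half_eremBar_of_le_klCTu8T`** (generic `G` with `θ = ½`, `2¹⁰ ≤ cloc`) and its instances `…_klEngGeo11/14_of_le_klCTu8T`: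
  `E₂(klCT8) ≤ ½·eremBar G P Q U β L n` from `0 < U ≤ klCTu8T …`, `(KlamU)² ≤ 1`, the `Q`-floor `2⁶⁰Psq²Rsq² ≤ Q.CR`, `2⁶⁰Psq²Rsq²(β²+1)4ⁿ ≤ Q.CL β n`;
* §2 **`hout_hE_klCT8_of_le_klCTu8T`** — the `hE` binder at `s = ¼` (`2·¼·erem + E₂(klCT8) ≤ erem`, erem literal at `klEngGeo11`) and **`hout_hE_klCT8_klEngGeo14_of_le_klCTu8T`**
  (the same literal at `klEngGeo14`; `eremBar_klEngGeo14_eq`: the erem slot reads no gain);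
* §3 **`outClass_hout_le_bars_klEngGeo14_klCT8`** — k3c2-p2's `outClass_hout_le_bars_klEngGeo14_of_cap` at `r := klCT8` WITH `hE` DISCHARGED (`Ē := eremBar klEngGeo11 P Q U β L n`,
  step (i)'s residue `E₁ := 2·¼·eremBar klEngGeo11 …`): `hshift`, `h₁`, `h₃`, `hD` + the u-slot / `(KlamU)² ≤ 1` / `Q`-floor binders ⇒ the out-of-class bracket at `klEngGeo14`.
Composition of landed lemmas; no definition; nothing about the model is asserted; nothing asserts (E2″-F), (c), (X).3, K3 or superconductivity.  0 kit · 0 lit.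
-/

noncomputable section

namespace Summit.HubbardSuperconductivity.HubbardSuperconductivity.Theorems.EngineV8

set_option linter.dupNamespace false -- summit = problem name (single-conjunct summit), D-0017

open Real Finset Literature.MathematicalPhysics.QuantumLattice Literature.Probability.LatticeModels
open Summit.HubbardSuperconductivity.HubbardSuperconductivity.Theorems.KLRegimeSplit
open Summit.HubbardSuperconductivity.HubbardSuperconductivity.Theorems.KLProgrammeLegKernels
open Summit.HubbardSuperconductivity.HubbardSuperconductivity.Theorems.DispersionFlow

/-! ## §1 The capped residue at `r := klCT8`, `hTU` from the bundled u-slot -/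

section Residue

variable {L : ℕ}

/-- **`E₂(klCT8) ≤ ½·eremBar G P Q U β L n`** for an engine package `G` with `θ = ½`, `2¹⁰ ≤ cloc`, from `0 < U ≤ klCTu8T P R Q₀ G′ klEngGeoTh Qu cc` (the bundled class-#5
u-slot: producer threshold ∧ the cap's U-side booking), `(KlamU)² ≤ 1`, `0 ≤ Klam` and the `Q`-floor of record — `relBar_cap_residue_le_half_eremBar_of_U` at
`hr := klCT8_nonneg`, `hrc := klCT8_le_cap`, `hTU := hTU_of_le_klCTu8T`. -/
theorem relBar_klCT8_residue_le_half_eremBar_of_le_klCTu8T {G : GeoConsts} (hθ : G.θ = 1 / 2) (hcloc : 2 ^ 10 ≤ G.cloc) {P : SplitConsts} (hKl : 0 ≤ P.Klam)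
    (R : RenConsts) (Q₀ : EngConsts) (G' : GeoConsts) (Q Qu : EngConsts) {U β cc : ℝ} (L n : ℕ) (hKU : (P.Klam * U) ^ 2 ≤ 1) (hU : 0 < U)
    (hUle : U ≤ klCTu8T P R Q₀ G' klEngGeoTh Qu cc)
    (hQCR : 2 ^ 60 * klEngPsq P ^ 2 * klEngRsq R ^ 2 ≤ Q.CR) (hQCL : 2 ^ 60 * klEngPsq P ^ 2 * klEngRsq R ^ 2 * (β ^ 2 + 1) * (4 : ℝ) ^ n ≤ Q.CL β n) :
    2 * klCT8 P R Q₀ G' klEngGeoTh * 15367 * ((P.Klam * U) ^ 2 * ((L : ℝ))⁻¹) +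
        4 * klCT8 P R Q₀ G' klEngGeoTh * 15367 * ((P.Klam * |U|) ^ 3 * ((2 : ℝ) ^ (n + 1))⁻¹) ≤
      2⁻¹ * eremBar G P Q U β L n :=
  relBar_cap_residue_le_half_eremBar_of_U hθ hcloc hKl R Q L n (klCT8_nonneg P R Q₀ G' klEngGeoTh) (klCT8_le_cap P R Q₀ G' klEngGeoTh) hKU
    (hTU_of_le_klCTu8T hU hUle) hQCR hQCL

/-- **Instance at `klEngGeo11`.** -/
theorem relBar_klCT8_residue_le_half_eremBar_klEngGeo11_of_le_klCTu8T {P : SplitConsts} (hKl : 0 ≤ P.Klam) (R : RenConsts) (Q₀ : EngConsts) (G' : GeoConsts)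
    (Q Qu : EngConsts) {U β cc : ℝ} (L n : ℕ) (hKU : (P.Klam * U) ^ 2 ≤ 1) (hU : 0 < U) (hUle : U ≤ klCTu8T P R Q₀ G' klEngGeoTh Qu cc)
    (hQCR : 2 ^ 60 * klEngPsq P ^ 2 * klEngRsq R ^ 2 ≤ Q.CR) (hQCL : 2 ^ 60 * klEngPsq P ^ 2 * klEngRsq R ^ 2 * (β ^ 2 + 1) * (4 : ℝ) ^ n ≤ Q.CL β n) :
    2 * klCT8 P R Q₀ G' klEngGeoTh * 15367 * ((P.Klam * U) ^ 2 * ((L : ℝ))⁻¹) +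
        4 * klCT8 P R Q₀ G' klEngGeoTh * 15367 * ((P.Klam * |U|) ^ 3 * ((2 : ℝ) ^ (n + 1))⁻¹) ≤
      2⁻¹ * eremBar klEngGeo11 P Q U β L n :=
  relBar_klCT8_residue_le_half_eremBar_of_le_klCTu8T klEngGeo11_θ_eq (le_of_eq klEngGeo11_cloc_eq.symm) hKl R Q₀ G' Q Qu L n hKU hU hUle hQCR hQCL

/-- **Instance at `klEngGeo14`.** -/
theorem relBar_klCT8_residue_le_half_eremBar_klEngGeo14_of_le_klCTu8T {P : SplitConsts} (hKl : 0 ≤ P.Klam) (R : RenConsts) (Q₀ : EngConsts) (G' : GeoConsts)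
    (Q Qu : EngConsts) {U β cc : ℝ} (L n : ℕ) (hKU : (P.Klam * U) ^ 2 ≤ 1) (hU : 0 < U) (hUle : U ≤ klCTu8T P R Q₀ G' klEngGeoTh Qu cc)
    (hQCR : 2 ^ 60 * klEngPsq P ^ 2 * klEngRsq R ^ 2 ≤ Q.CR) (hQCL : 2 ^ 60 * klEngPsq P ^ 2 * klEngRsq R ^ 2 * (β ^ 2 + 1) * (4 : ℝ) ^ n ≤ Q.CL β n) :
    2 * klCT8 P R Q₀ G' klEngGeoTh * 15367 * ((P.Klam * U) ^ 2 * ((L : ℝ))⁻¹) +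
        4 * klCT8 P R Q₀ G' klEngGeoTh * 15367 * ((P.Klam * |U|) ^ 3 * ((2 : ℝ) ^ (n + 1))⁻¹) ≤
      2⁻¹ * eremBar klEngGeo14 P Q U β L n :=
  relBar_klCT8_residue_le_half_eremBar_of_le_klCTu8T klEngGeo14_θ_eq (le_of_eq klEngGeo14_cloc_eq.symm) hKl R Q₀ G' Q Qu L n hKU hU hUle hQCR hQCL

end Residue

/-! ## §2 The `hE` binder at `s = ¼` -/

section HE

variable {L : ℕ}

/-- **THE `hE` BINDER AT `klCT8` UNDER THE BUNDLED u-SLOT** (`s = ¼`, erem literal at `klEngGeo11`): `2·¼·erem + E₂(klCT8) ≤ erem` — `hout_hE_cap_of_U` at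
`hr := klCT8_nonneg`, `hrc := klCT8_le_cap`, `hTU := hTU_of_le_klCTu8T hU hUle`. -/
theorem hout_hE_klCT8_of_le_klCTu8T {P : SplitConsts} (hP : P.WF) (R : RenConsts) {Q : EngConsts} (hQ : Q.WF) (Q₀ : EngConsts) (G' : GeoConsts) (Qu : EngConsts)
    {U β cc : ℝ} (L n : ℕ) (hKU : (P.Klam * U) ^ 2 ≤ 1) (hU : 0 < U) (hUle : U ≤ klCTu8T P R Q₀ G' klEngGeoTh Qu cc)
    (hQCR : 2 ^ 60 * klEngPsq P ^ 2 * klEngRsq R ^ 2 ≤ Q.CR) (hQCL : 2 ^ 60 * klEngPsq P ^ 2 * klEngRsq R ^ 2 * (β ^ 2 + 1) * (4 : ℝ) ^ n ≤ Q.CL β n) :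
    2 * 4⁻¹ * eremBar klEngGeo11 P Q U β L n +
        (2 * klCT8 P R Q₀ G' klEngGeoTh * 15367 * ((P.Klam * U) ^ 2 * ((L : ℝ))⁻¹) +
          4 * klCT8 P R Q₀ G' klEngGeoTh * 15367 * ((P.Klam * |U|) ^ 3 * ((2 : ℝ) ^ (n + 1))⁻¹)) ≤
      eremBar klEngGeo11 P Q U β L n :=
  hout_hE_cap_of_U hP R hQ L n (klCT8_nonneg P R Q₀ G' klEngGeoTh) (klCT8_le_cap P R Q₀ G' klEngGeoTh) hKU (hTU_of_le_klCTu8T hU hUle) hQCR hQCL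

/-- **The same with the erem literal at `klEngGeo14`** (`eremBar_klEngGeo14_eq`: the erem slot reads no gain or `CF`). -/
theorem hout_hE_klCT8_klEngGeo14_of_le_klCTu8T {P : SplitConsts} (hP : P.WF) (R : RenConsts) {Q : EngConsts} (hQ : Q.WF) (Q₀ : EngConsts) (G' : GeoConsts)
    (Qu : EngConsts) {U β cc : ℝ} (L n : ℕ) (hKU : (P.Klam * U) ^ 2 ≤ 1) (hU : 0 < U) (hUle : U ≤ klCTu8T P R Q₀ G' klEngGeoTh Qu cc)
    (hQCR : 2 ^ 60 * klEngPsq P ^ 2 * klEngRsq R ^ 2 ≤ Q.CR) (hQCL : 2 ^ 60 * klEngPsq P ^ 2 * klEngRsq R ^ 2 * (β ^ 2 + 1) * (4 : ℝ) ^ n ≤ Q.CL β n) :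
    2 * 4⁻¹ * eremBar klEngGeo14 P Q U β L n +
        (2 * klCT8 P R Q₀ G' klEngGeoTh * 15367 * ((P.Klam * U) ^ 2 * ((L : ℝ))⁻¹) +
          4 * klCT8 P R Q₀ G' klEngGeoTh * 15367 * ((P.Klam * |U|) ^ 3 * ((2 : ℝ) ^ (n + 1))⁻¹)) ≤
      eremBar klEngGeo14 P Q U β L n := by
  rw [eremBar_klEngGeo14_eq]
  exact hout_hE_klCT8_of_le_klCTu8T hP R hQ Q₀ G' Qu L n hKU hU hUle hQCR hQCL

end HE

/-! ## §3 The out-of-class bracket at `klEngGeo14` fed by the bar at `klCT8`, `hE` discharged -/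

section Bracket

variable {L : ℕ}

/-- **THE OUT-OF-CLASS BRACKET AT `klEngGeo14` FOR THE BAR OF RECORD AT `klCT8`, `hE` DISCHARGED** — `outClass_hout_le_bars_klEngGeo14_of_cap` at `r := klCT8 P R Q₀ G′ klEngGeoTh`
with `Ē := eremBar klEngGeo11 P Q U β L n` and step (i)'s residue `E₁ := 2·¼·eremBar klEngGeo11 …` (`hout_hE_klCT8_of_le_klCTu8T`): from the frame-shift row `hshift`, step (i)'s
same-frame row `h₁` at `klEngGeo11` sizes, the transfer row `h₃` (bar + the two-shell xs term), `0 ≤ D`, and the binders `0 < U ≤ klCTu8T …`, `(KlamU)² ≤ 1`, `Q`-floor: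
`‖a − d‖ ≤ gainBar klEngGeo14 … + eremBar klEngGeo11 … + thermalBar klEngGeo14 … + D + frameShiftBar …`. -/
theorem outClass_hout_le_bars_klEngGeo14_klCT8 {P : SplitConsts} (hP : P.WF) (R : RenConsts) {Q : EngConsts} (hQ : Q.WF) (Q₀ : EngConsts) (G' : GeoConsts)
    (Qu : EngConsts) {U β cc : ℝ} {n : ℕ} (Qm k k' : TorusSite 2 L) {a b c d : ℂ} {D : ℝ}
    (hKU : (P.Klam * U) ^ 2 ≤ 1) (hU : 0 < U) (hUle : U ≤ klCTu8T P R Q₀ G' klEngGeoTh Qu cc)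
    (hQCR : 2 ^ 60 * klEngPsq P ^ 2 * klEngRsq R ^ 2 ≤ Q.CR) (hQCL : 2 ^ 60 * klEngPsq P ^ 2 * klEngRsq R ^ 2 * (β ^ 2 + 1) * (4 : ℝ) ^ n ≤ Q.CL β n)
    (hshift : ‖a - b‖ ≤ frameShiftBar P Q U (n + 1))
    (h₁ : ‖b - c‖ ≤ gainBar klEngGeo11 P U (n + 1) (klTorusNorm L Qm) (klTorusNorm L (k - k')) (klTorusNorm L (k + k' - Qm)) +
      2 * 4⁻¹ * eremBar klEngGeo11 P Q U β L n + thermalBar klEngGeo11 P U β (n + 1))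
    (h₃ : ‖c - d‖ ≤ transferBarRelIdx L klEngGeoTh P (klCT8 P R Q₀ G' klEngGeoTh) β U n n Qm k k' +
      (P.Klam * U) ^ 2 * ((2 ^ 17 * klTS + 2 ^ 27) * (klRelGain n (klTorusNorm L Qm) + ((2 : ℝ) ^ n)⁻¹)))
    (hD : 0 ≤ D) :
    ‖a - d‖ ≤ gainBar klEngGeo14 P U (n + 1) (klTorusNorm L Qm) (klTorusNorm L (k - k')) (klTorusNorm L (k + k' - Qm)) + eremBar klEngGeo11 P Q U β L n +
      thermalBar klEngGeo14 P U β (n + 1) + D + frameShiftBar P Q U (n + 1) :=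
  outClass_hout_le_bars_klEngGeo14_of_cap (L := L) (zero_le_one.trans hP.1) (klCT8_nonneg P R Q₀ G' klEngGeoTh) (klCT8_le_cap P R Q₀ G' klEngGeoTh) Qm k k'
    hshift h₁ h₃ (hout_hE_klCT8_of_le_klCTu8T hP R hQ Q₀ G' Qu L n hKU hU hUle hQCR hQCL) hD

/-- **The same bracket with the erem literal at `klEngGeo14`** in both `h₁` and the conclusion (`eremBar_klEngGeo14_eq`). -/
theorem outClass_hout_le_bars_klEngGeo14_klCT8' {P : SplitConsts} (hP : P.WF) (R : RenConsts) {Q : EngConsts} (hQ : Q.WF) (Q₀ : EngConsts) (G' : GeoConsts)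
    (Qu : EngConsts) {U β cc : ℝ} {n : ℕ} (Qm k k' : TorusSite 2 L) {a b c d : ℂ} {D : ℝ}
    (hKU : (P.Klam * U) ^ 2 ≤ 1) (hU : 0 < U) (hUle : U ≤ klCTu8T P R Q₀ G' klEngGeoTh Qu cc)
    (hQCR : 2 ^ 60 * klEngPsq P ^ 2 * klEngRsq R ^ 2 ≤ Q.CR) (hQCL : 2 ^ 60 * klEngPsq P ^ 2 * klEngRsq R ^ 2 * (β ^ 2 + 1) * (4 : ℝ) ^ n ≤ Q.CL β n)
    (hshift : ‖a - b‖ ≤ frameShiftBar P Q U (n + 1))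
    (h₁ : ‖b - c‖ ≤ gainBar klEngGeo11 P U (n + 1) (klTorusNorm L Qm) (klTorusNorm L (k - k')) (klTorusNorm L (k + k' - Qm)) +
      2 * 4⁻¹ * eremBar klEngGeo14 P Q U β L n + thermalBar klEngGeo11 P U β (n + 1))
    (h₃ : ‖c - d‖ ≤ transferBarRelIdx L klEngGeoTh P (klCT8 P R Q₀ G' klEngGeoTh) β U n n Qm k k' +
      (P.Klam * U) ^ 2 * ((2 ^ 17 * klTS + 2 ^ 27) * (klRelGain n (klTorusNorm L Qm) + ((2 : ℝ) ^ n)⁻¹)))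
    (hD : 0 ≤ D) :
    ‖a - d‖ ≤ gainBar klEngGeo14 P U (n + 1) (klTorusNorm L Qm) (klTorusNorm L (k - k')) (klTorusNorm L (k + k' - Qm)) + eremBar klEngGeo14 P Q U β L n +
      thermalBar klEngGeo14 P U β (n + 1) + D + frameShiftBar P Q U (n + 1) := by
  rw [eremBar_klEngGeo14_eq] at h₁ ⊢
  exact outClass_hout_le_bars_klEngGeo14_klCT8 hP R hQ Q₀ G' Qu Qm k k' hKU hU hUle hQCR hQCL hshift h₁ h₃ hD

end Bracket

end Summit.HubbardSuperconductivity.HubbardSuperconductivity.Theorems.EngineV8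

end
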